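import Mathlib
import HarnessLib

/-!
# Enflo 2023, v2 p.20 after (46): the room claim, typed and refuted; what does follow from rooms

Source under adjudication: Per H. Enflo, *On the invariant subspace problem in Hilbert spaces*, arXiv:2305.15442 (v1
2023, v2 2024), bib key `Enflo2023` — a CLAIMED proof of the invariant subspace problem for operators on a separable
Hilbert space.  This file is part of the kernel-tight typing of the manuscript by the b2b-enflo repair cell
(formaliser 2, Part B: (28)–(47), the limiting argument and the final deduction).  It records what FOLLOWS (proved
implications from the manuscript's displayed hypotheses) and, where a step does not follow, the typed inference
together with its refutation.  NOTHING here asserts that the manuscript's main theorem holds; no declaration concludes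
the invariant subspace problem for an arbitrary operator.  Value (BLOCK-2b): theorems / refutations of typed
inferences about a text — not progress on the problem.

EnfloISP — Part B (formaliser 2).  THE GAP: v2 p.20, the two sentences after eq. (46) (LaTeX lines 675–683):

  "Then, since ⟨T^{*j₁} y'_n, y'_n⟩ = ⟨y'_n, T^{j₁} y'_n⟩ we get that the triple
   V_{y_n}V_{y_n}^*(x₀ − [ ]⁻¹x₀), V_{y_n}V_{y_n}^*(w₀₀), y_n is δ₂-linearly independent to arbitrarily small
   εθ's, since with the condition ⟨ch[ ]⁻¹_n x₀, w₀₀⟩ = 0 the room for variation of [ ]⁻¹_n x₀ is less than δ₂^40.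
   … The room for variation of [ ]⁻¹_n x₀ is less than δ₂^400.  By continuing with smaller and smaller (εθ)'s,
   w₀₀, w₀₁, w₀₂, … we have that V_{y_n}V_{y_n}^*[ ]⁻¹_n x₀ converges to a non-cyclic vector."

No argument is given for the ROOM claim ("the room for variation of [ ]⁻¹_n x₀ is less than δ₂^40"), and the whole
type-1 conclusion (and case 1.) of type 2) rests on it: it is what turns the "(εθ)_n-almost non-cyclic" iterates
into a NORM-convergent sequence, after which (11) (file LimitStep.lean, closed) applies.

This file does three things, all sorry-free:
(1) `RoomClaim ρ` — the inference typed with, as hypotheses, everything the text has established about the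
    sequence v_n = [ ]⁻¹_n x₀ at that point: ‖x₀‖ = 1; 0.3 ≤ ⟨[ ]⁻¹_n x₀, x₀⟩ ≤ 0.7 (p.17, kept by MC);
    (εθ)_n = ⟨[ ]⁻¹_n x₀, x₀ − [ ]⁻¹_n x₀⟩ > 0 strictly decreasing to 0, by a factor ≤ (1 − β) per step ((31), p.19);
    |change of ⟨[ ]⁻¹x₀, x₀⟩| ≤ 10 β (εθ) per step ((45)); and the added condition ⟨ch([ ]⁻¹_n x₀), w₀₀⟩ = 0, imposed
    here EXACTLY (not only to first order, which is weaker).  Conclusion: ‖v_n − v_0‖ ≤ ρ for all n.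
(2) `not_roomClaim`: RoomClaim ρ is FALSE for every ρ < 0.6 (the paper needs ρ = δ₂^40 ≤ ‖T‖^40 = 10^{-800}):
    an explicit sequence in any Hilbert space containing four orthonormal vectors satisfies every hypothesis and
    has ‖v_{n+1} − v_n‖² ≥ 0.46 for all n — so it is not even Cauchy (`model_not_cauchySeq`).  Lean therefore
    REFUSES the inference as written: the listed facts do not confine [ ]⁻¹_n x₀; what is missing is any estimate
    on the components of the increments OUTSIDE span{x₀, w₀₀} (in the paper's setting: outside the three
    functionals controlled by (28″)–(30″) plus the one added constraint) — an infinite-dimensional freedom.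
(3) What DOES follow (`cauchySeq_of_rooms` here; `hasNontrivialClosedInvariantSubspace_of_rooms` in RoomsSuffice.lean): IF room bounds
    ρ_k → 0 held from pivots n_k on (the paper's δ₂^40, δ₂^400, …), the sequence would be Cauchy, hence norm
    convergent, and (11) would give the invariant subspace.  So the gap is exactly the room claim.
Dictionary: paper ⟨u, v⟩ = Mathlib `⟪v, u⟫_ℂ`.
-/

open scoped InnerProductSpace
open Filter Topology RCLike

namespace Literature.Analysis.OperatorTheory.Enflo2023

/-! ### (1) The inference, typed -/

/-- v2 p.20 after (46), as an inference from the facts in hand.  `v n` = [ ]⁻¹_{n₀'+n} x₀, `w` = w₀₀,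
`εθ n` = (εθ)_{n₀'+n}, `β` = the MC step parameter, `ρ` = the claimed room (δ₂^40). -/
@[claim "Enflo2023" "disputed"]
def RoomClaim (ρ : ℝ) : Prop :=
  ∀ (H : Type) [NormedAddCommGroup H] [InnerProductSpace ℂ H] [CompleteSpace H]
    (x₀ w : H) (v : ℕ → H) (εθ : ℕ → ℝ) (β : ℝ),
    ‖x₀‖ = 1 → w ≠ 0 → 0 < β → β < 1 →
    (∀ n, (0.3 : ℝ) ≤ re ⟪x₀, v n⟫_ℂ ∧ re ⟪x₀, v n⟫_ℂ ≤ 0.7) →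
    (∀ n, (εθ n : ℂ) = ⟪v n, x₀ - v n⟫_ℂ) →
    (∀ n, 0 < εθ n) → StrictAnti εθ → Tendsto εθ atTop (𝓝 0) →
    (∀ n, εθ (n + 1) ≤ (1 - β) * εθ n) →
    (∀ n, ‖⟪x₀, v (n + 1) - v n⟫_ℂ‖ ≤ 10 * β * εθ n) →
    (∀ n, ⟪w, v (n + 1) - v n⟫_ℂ = 0) →
    ∀ n, ‖v n - v 0‖ ≤ ρ

/-! ### (2) The counter-model -/

namespace RoomModel

variable {H : Type*} [NormedAddCommGroup H] [InnerProductSpace ℂ H]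

/-- (εθ)_n of the model: `(1/100)·2^{-n}`. [cite: Enflo2023, v2 p.20, after (46)] -/
noncomputable def epsModel (n : ℕ) : ℝ := (1 / 100) * (1 / 2) ^ n

/-- Model: `(εθ)_n > 0`. [cite: Enflo2023, v2 p.20, after (46)] -/
lemma epsModel_pos (n : ℕ) : 0 < epsModel n := by unfold epsModel; positivity

/-- Model: `(εθ)_n ≤ 1/100`. [cite: Enflo2023, v2 p.20, after (46)] -/
lemma epsModel_le (n : ℕ) : epsModel n ≤ 1 / 100 := by
  unfold epsModel
  have : (1 / 2 : ℝ) ^ n ≤ 1 := pow_le_one₀ (by norm_num) (by norm_num)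
  nlinarith

/-- Model: `(εθ)_{n+1} = (εθ)_n / 2` (so `β = 1/2`). [cite: Enflo2023, v2 p.20, after (46)] -/
lemma epsModel_succ (n : ℕ) : epsModel (n + 1) = (1 / 2) * epsModel n := by
  unfold epsModel; rw [pow_succ]; ring

/-- Model: `(εθ)_n` is strictly decreasing. [cite: Enflo2023, v2 p.20, after (46)] -/
lemma epsModel_strictAnti : StrictAnti epsModel := by
  refine strictAnti_nat_of_succ_lt fun n => ?_
  rw [epsModel_succ]; have := epsModel_pos n; linarith

/-- Model: `(εθ)_n → 0`. [cite: Enflo2023, v2 p.20, after (46)] -/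
lemma epsModel_tendsto : Tendsto epsModel atTop (𝓝 0) := by
  have h : Tendsto (fun n : ℕ => (1 / 2 : ℝ) ^ n) atTop (𝓝 0) :=
    tendsto_pow_atTop_nhds_zero_of_lt_one (by norm_num) (by norm_num)
  have h2 := h.const_mul (1 / 100 : ℝ)
  rw [mul_zero] at h2
  exact h2

/-- radial coefficient `d_n = √(0.24 − (εθ)_n)`. [cite: Enflo2023, v2 p.20, after (46)] -/
noncomputable def dModel (n : ℕ) : ℝ := Real.sqrt (0.24 - epsModel n)

/-- Model: `d_n² = 0.24 − (εθ)_n`. [cite: Enflo2023, v2 p.20, after (46)] -/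
lemma dModel_sq (n : ℕ) : dModel n ^ 2 = 0.24 - epsModel n := by
  unfold dModel; rw [Real.sq_sqrt]; have := epsModel_le n; linarith

/-- the moving direction: `e 2` at even steps, `e 3` at odd steps. [cite: Enflo2023, v2 p.20, after (46)] -/
noncomputable def uModel (e : Fin 4 → H) (n : ℕ) : H := if Even n then e 2 else e 3

/-- THE MODEL SEQUENCE `v n = (2/5)·e₀ + d_n·u_n` (x₀ = e₀, w₀₀ = e₁). [cite: Enflo2023, v2 p.20, after (46)] -/
noncomputable def vModel (e : Fin 4 → H) (n : ℕ) : H :=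
  ((2 / 5 : ℝ) : ℂ) • e 0 + ((dModel n : ℝ) : ℂ) • uModel e n

variable {e : Fin 4 → H} (he : Orthonormal ℂ e)
include he

/-- Inner products of the orthonormal frame `e`. [cite: Enflo2023, v2 p.20, after (46)] -/
private lemma e_inner (i j : Fin 4) : ⟪e i, e j⟫_ℂ = if i = j then 1 else 0 :=
  orthonormal_iff_ite.mp he i j

/-- Model: the moving direction is orthogonal to `x₀ = e 0`. [cite: Enflo2023, v2 p.20, after (46)] -/
lemma inner_e0_u (n : ℕ) : ⟪e 0, uModel e n⟫_ℂ = 0 := by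
  unfold uModel; split_ifs <;> simp [e_inner he]

/-- Model: the moving direction is orthogonal to `w₀₀ = e 1`. [cite: Enflo2023, v2 p.20, after (46)] -/
lemma inner_e1_u (n : ℕ) : ⟪e 1, uModel e n⟫_ℂ = 0 := by
  unfold uModel; split_ifs <;> simp [e_inner he]

/-- Model: `⟪u_n, e 0⟫ = 0`. [cite: Enflo2023, v2 p.20, after (46)] -/
lemma inner_u_e0 (n : ℕ) : ⟪uModel e n, e 0⟫_ℂ = 0 := by
  rw [← inner_conj_symm, inner_e0_u he, map_zero]

/-- Model: `u_n` is a unit vector. [cite: Enflo2023, v2 p.20, after (46)] -/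
lemma inner_u_self (n : ℕ) : ⟪uModel e n, uModel e n⟫_ℂ = 1 := by
  unfold uModel; split_ifs <;> (rw [e_inner he]; simp)

/-- Model: consecutive directions are orthogonal. [cite: Enflo2023, v2 p.20, after (46)] -/
lemma inner_u_succ (n : ℕ) : ⟪uModel e n, uModel e (n + 1)⟫_ℂ = 0 := by
  unfold uModel
  rcases Nat.even_or_odd n with h | h
  · have h' : ¬ Even (n + 1) := by rw [Nat.not_even_iff_odd]; exact h.add_one
    simp [h, h', e_inner he]
  · have h' : Even (n + 1) := h.add_one
    have h'' : ¬ Even n := by rw [Nat.not_even_iff_odd]; exact h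
    simp [h', h'', e_inner he]

/-- Model: `⟪x₀, v_n⟫ = 2/5` for every `n` (inside the window `[0.3, 0.7]` of (46)). [cite: Enflo2023, v2 p.20, after (46)] -/
lemma inner_x0_v (n : ℕ) : ⟪e 0, vModel e n⟫_ℂ = (2 / 5 : ℝ) := by
  unfold vModel
  rw [inner_add_right, inner_smul_right, inner_smul_right, inner_e0_u he, e_inner he]
  simp

/-- Model: `‖v_n‖² = (2/5)² + d_n²`. [cite: Enflo2023, v2 p.20, after (46)] -/
lemma inner_v_v (n : ℕ) : ⟪vModel e n, vModel e n⟫_ℂ = (((2 / 5 : ℝ) ^ 2 + dModel n ^ 2 : ℝ) : ℂ) := by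
  unfold vModel
  simp only [inner_add_left, inner_add_right, inner_smul_left, inner_smul_right, inner_e0_u he,
    inner_u_e0 he, inner_u_self he, e_inner he, Complex.conj_ofReal]
  push_cast
  ring

/-- Model: `⟨v_n, x₀ − v_n⟩ = (εθ)_n` — the defining relation of `(εθ)_n`. [cite: Enflo2023, v2 p.20, after (46)] -/
lemma inner_v_x0_sub_v (n : ℕ) : ⟪vModel e n, e 0 - vModel e n⟫_ℂ = (epsModel n : ℂ) := by
  rw [inner_sub_right, inner_v_v he, ← inner_conj_symm, inner_x0_v he]
  have := dModel_sq n
  simp only [Complex.conj_ofReal]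
  norm_cast
  rw [this]; ring

omit he in
/-- Model: the step `v_{n+1} − v_n = d_{n+1}u_{n+1} − d_nu_n`. [cite: Enflo2023, v2 p.20, after (46)] -/
lemma vModel_succ_sub (n : ℕ) : vModel e (n + 1) - vModel e n
    = ((dModel (n + 1) : ℝ) : ℂ) • uModel e (n + 1) - ((dModel n : ℝ) : ℂ) • uModel e n := by
  unfold vModel; abel

/-- Model: the step is orthogonal to `x₀` (so `|⟨x₀, step⟩| ≤ 10β(εθ)_n` trivially). [cite: Enflo2023, v2 p.20, after (46)] -/
lemma inner_x0_step (n : ℕ) : ⟪e 0, vModel e (n + 1) - vModel e n⟫_ℂ = 0 := by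
  rw [vModel_succ_sub, inner_sub_right, inner_smul_right, inner_smul_right, inner_e0_u he,
    inner_e0_u he]; simp

/-- Model: the step is orthogonal to `w₀₀` (the exact constraint of (46)). [cite: Enflo2023, v2 p.20, after (46)] -/
lemma inner_w_step (n : ℕ) : ⟪e 1, vModel e (n + 1) - vModel e n⟫_ℂ = 0 := by
  rw [vModel_succ_sub, inner_sub_right, inner_smul_right, inner_smul_right, inner_e1_u he,
    inner_e1_u he]; simp

/-- the squared step length: `‖v_{n+1} − v_n‖² = d_{n+1}² + d_n² = 0.48 − (εθ)_{n+1} − (εθ)_n`. [cite: Enflo2023, v2 p.20, after (46)] -/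
lemma norm_step_sq (n : ℕ) :
    ‖vModel e (n + 1) - vModel e n‖ ^ 2 = 0.48 - epsModel (n + 1) - epsModel n := by
  have key : (⟪vModel e (n + 1) - vModel e n, vModel e (n + 1) - vModel e n⟫_ℂ)
      = ((dModel (n + 1) ^ 2 + dModel n ^ 2 : ℝ) : ℂ) := by
    rw [vModel_succ_sub]
    have h1 := inner_u_succ he n
    have h2 : ⟪uModel e (n + 1), uModel e n⟫_ℂ = 0 := by rw [← inner_conj_symm, h1, map_zero]
    simp only [inner_sub_left, inner_sub_right, inner_smul_left, inner_smul_right, inner_u_self he, h1,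
      h2, Complex.conj_ofReal]
    push_cast; ring
  have h := @inner_self_eq_norm_sq_to_K ℂ H _ _ _ (vModel e (n + 1) - vModel e n)
  rw [h] at key
  have key' : (‖vModel e (n + 1) - vModel e n‖ ^ 2 : ℝ) = dModel (n + 1) ^ 2 + dModel n ^ 2 := by
    apply Complex.ofReal_injective
    push_cast
    first | exact key | simpa using key
  rw [key', dModel_sq, dModel_sq]; ring

/-- Model: every step has length `≥ 0.67`. [cite: Enflo2023, v2 p.20, after (46)] -/
lemma norm_step_ge (n : ℕ) : (0.67 : ℝ) ≤ ‖vModel e (n + 1) - vModel e n‖ := by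
  have h := norm_step_sq he n
  have h1 := epsModel_le (n + 1); have h2 := epsModel_le n
  nlinarith [norm_nonneg (vModel e (n + 1) - vModel e n)]

/-- The model sequence is not Cauchy: consecutive terms stay ≥ 0.67 apart. [cite: Enflo2023, v2 p.20, after (46)] -/
theorem model_not_cauchySeq : ¬ CauchySeq (vModel e) := by
  intro hc
  obtain ⟨N, hN⟩ := Metric.cauchySeq_iff.mp hc (1 / 2) (by norm_num)
  have h := hN (N + 1) (by omega) N le_rfl
  rw [dist_eq_norm] at h
  have := norm_step_ge he N
  linarith

omit [InnerProductSpace ℂ H] he in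
/-- Every hypothesis of `RoomClaim` holds for the model (with x₀ = e₀, w₀₀ = e₁, β = 1/2), yet
‖v₁ − v₀‖ ≥ 0.67. [cite: Enflo2023, v2 p.20, after (46)] -/
theorem model_violates (ρ : ℝ) (hρ : ρ < 0.6) (hRC : RoomClaim ρ)
    (H' : Type) [NormedAddCommGroup H'] [InnerProductSpace ℂ H'] [CompleteSpace H']
    (e' : Fin 4 → H') (he' : Orthonormal ℂ e') : False := by
  have hx₀ : ‖e' 0‖ = 1 := he'.1 0
  have hw : e' 1 ≠ 0 := by
    intro h; have := he'.1 1; rw [h, norm_zero] at this; exact zero_ne_one this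
  have H1 : ∀ n, (0.3 : ℝ) ≤ re ⟪e' 0, vModel e' n⟫_ℂ ∧ re ⟪e' 0, vModel e' n⟫_ℂ ≤ 0.7 := by
    intro n; rw [inner_x0_v he']; norm_num
  have H2 : ∀ n, (epsModel n : ℂ) = ⟪vModel e' n, e' 0 - vModel e' n⟫_ℂ :=
    fun n => (inner_v_x0_sub_v he' n).symm
  have H3 : ∀ n, epsModel (n + 1) ≤ (1 - 1 / 2) * epsModel n := by
    intro n; rw [epsModel_succ]; norm_num
  have H4 : ∀ n, ‖⟪e' 0, vModel e' (n + 1) - vModel e' n⟫_ℂ‖ ≤ 10 * (1 / 2) * epsModel n := by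
    intro n; rw [inner_x0_step he', norm_zero]; have := epsModel_pos n; positivity
  have H5 : ∀ n, ⟪e' 1, vModel e' (n + 1) - vModel e' n⟫_ℂ = 0 := inner_w_step he'
  have hall := hRC H' (e' 0) (e' 1) (vModel e') epsModel (1 / 2) hx₀ hw (by norm_num) (by norm_num)
    H1 H2 epsModel_pos epsModel_strictAnti epsModel_tendsto H3 H4 H5 1
  have hstep := norm_step_ge he' 0
  simp only [zero_add] at hstep
  linarith

end RoomModel

open RoomModel in
/-- **Lean refuses the inference of v2 p.20 (after (46)).**  For every ρ < 0.6 — in particular for the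
paper's ρ = δ₂^40 ≤ 10^{-800} — `RoomClaim ρ` is false: witnessed in `EuclideanSpace ℂ (Fin 4)` (and, by
`model_violates`, in every Hilbert space containing four orthonormal vectors, e.g. every infinite-dimensional one). [cite: Enflo2023, v2 p.20, after (46)] -/
theorem not_roomClaim (ρ : ℝ) (hρ : ρ < 0.6) : ¬ RoomClaim ρ := by
  intro h
  exact model_violates ρ hρ h (EuclideanSpace ℂ (Fin 4))
    (fun i => EuclideanSpace.basisFun (Fin 4) ℂ i) (EuclideanSpace.basisFun (Fin 4) ℂ).orthonormal

/-! ### (3) What does follow: room bounds ⇒ Cauchy ⇒ (11) -/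

section Rooms

variable {H : Type*} [NormedAddCommGroup H] [InnerProductSpace ℂ H]

omit [InnerProductSpace ℂ H] in
/-- If from pivots `p k` on the sequence stays within `ρ k` of `v (p k)`, and `ρ k → 0`, then `v` is Cauchy.
(This is the paper's intended mechanism: rooms δ₂^40, δ₂^400, … from the pivots n₀', n₁', ….) [folklore] -/
theorem cauchySeq_of_rooms (v : ℕ → H) (p : ℕ → ℕ) (ρ : ℕ → ℝ)
    (hroom : ∀ k n, p k ≤ n → ‖v n - v (p k)‖ ≤ ρ k) (hρ : Tendsto ρ atTop (𝓝 0)) :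
    CauchySeq v := by
  refine Metric.cauchySeq_iff.mpr fun ε hε => ?_
  obtain ⟨k, hk⟩ := (hρ.eventually (gt_mem_nhds (show ε / 2 > 0 by positivity))).exists
  refine ⟨p k, fun m hm n hn => ?_⟩
  rw [dist_eq_norm]
  calc ‖v m - v n‖ = ‖(v m - v (p k)) - (v n - v (p k))‖ := by abel_nf
    _ ≤ ‖v m - v (p k)‖ + ‖v n - v (p k)‖ := norm_sub_le _ _
    _ ≤ ρ k + ρ k := add_le_add (hroom k m hm) (hroom k n hn)
    _ < ε := by linarith

end Rooms

end Literature.Analysis.OperatorTheory.Enflo2023
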